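import Mathlib
import HarnessLib
import Literature.Analysis.Convex.MoreauConeDecomposition

/-!
# The splitting conic solver iteration on the homogeneous self-dual embedding (SCS)

Literature anchor (statements and proofs follow the source; nothing here is new mathematics):

* [OCPB16] B. O'Donoghue, E. Chu, N. Parikh, S. Boyd, *Conic optimization via operator splitting
  and homogeneous self-dual embedding*, J. Optim. Theory Appl. 169 (2016) 1042–1068,
  arXiv:1312.3039 (held: `lit` key `paper-arxiv-1312.3039`; bib: OdonoghueEtAl2016):
  **§3.2.3** (the final algorithm (SCS): `ũ^{k+1} = (I + Q)⁻¹(u^k + v^k)`,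
  `u^{k+1} = Π_C(ũ^{k+1} − v^k)`, `v^{k+1} = v^k − ũ^{k+1} + u^{k+1}`; "the second and third steps
  [are] a combined Moreau decomposition"; "the algorithm is homogeneous"), **§3.4** (for all
  `k > 0`: `u^k ∈ C`, `v^k ∈ C*`, `(u^k)ᵀ v^k = 0`; the last step "can be rewritten as
  `v^{k+1} = Π_{C*}(v^k − ũ^{k+1})`"; a solution of the embedding is a fixed point of the iteration
  map `φ`; `‖(u^k, v^k) − γ(u⋆, v⋆)‖ ≤ ‖(u^0, v^0) − γ(u⋆, v⋆)‖` for every `γ > 0`, whence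
  `(u^k, v^k)ᵀ(u⋆, v⋆) ≥ (u⋆, v⋆)ᵀ(u^0, v^0)/2` and
  `‖(u^k, v^k)‖ ≥ (u⋆, v⋆)ᵀ(u^0, v^0) / (2‖(u⋆, v⋆)‖) > 0` — "eliminating convergence to zero"),
  and the **Appendix "Nonexpansivity"** (`φ = P ∘ L` with `P(x) = (Π_C(x), −Π_{−C*}(x))` and
  `L(u, v) = (I + Q)⁻¹(u + v) − v` both nonexpansive, the latter because
  `[(I + Q)⁻¹, −(I − (I + Q)⁻¹)]` times its transpose is `I` by the skew-symmetry of `Q`).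

Everything is proved; there are no named facts and no `sorry`.

## What is formalised, and the setting

[OCPB16] works in `ℝ^{m+n+1}` with the specific skew-symmetric matrix `Q` of the embedding and the
cone `C = ℝⁿ × K* × ℝ₊`. The statements above use only three structural facts — `C` is a closed
convex cone, `Q` is skew (`⟨Q x, x⟩ = 0`), and `(I + Q)⁻¹` exists — so they are recorded here over an
arbitrary real Hilbert space `E`, for a proper cone `K : ProperCone ℝ E` (Mathlib: nonempty closed
convex cone), a skew linear map `Q : E →ₗ[ℝ] E` (`IsSkew Q`) and a linear map `R` with
`R z + Q (R z) = z` (`IsResolvent Q R`, i.e. `R = (I + Q)⁻¹`; for skew `Q` the map `I + Q` is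
injective, `add_skew_injective`, so `R` is its two-sided inverse, `resolvent_apply_eq_iff`). The cone
projection `Π_K` and the dual cone `K* = ProperCone.innerDual K` are those of
`Literature.Analysis.Convex.MoreauDecomposition` (Moreau: `x = Π_K x − Π_{K*}(−x)`). The pair
`(u, v)` lives in the `L²` product `WithLp 2 (E × E)`, whose norm is `‖(u, v)‖² = ‖u‖² + ‖v‖²` as in
[OCPB16].

* `linStep R u v = R (u + v) − v` (the map `L`), `nextU K R u v = Π_K (linStep R u v)`,
  `nextV K R u v = nextU − linStep` and `scsStep K R : WithLp 2 (E × E) → WithLp 2 (E × E)` (one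
  iteration `φ`; `nextV_eq` is the third line of (SCS) verbatim, `nextV_eq_proj_innerDual` its
  `Π_{C*}` rewriting);
* §3.4 iterate guarantees: `nextU_mem`, `nextV_mem_innerDual`, `inner_nextU_nextV`, and along the
  orbit `scsIter` (`scsIter_fst_mem`, `scsIter_snd_mem_innerDual`, `inner_scsIter_fst_snd`);
* homogeneity: `scsStep_smul`;
* fixed points = solutions of the embedding `u ∈ K, v ∈ K*, Q u = v` (complementarity
  `⟨u, v⟩ = 0` being automatic for skew `Q`, `inner_skew_apply_self`): `scsStep_eq_self_iff`;
* Appendix: `norm_proj_sub_sq_add_le` (`P` nonexpansive), `norm_linStep_sub_sq_add_eq` (the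
  isometry identity behind `‖L‖ = 1`) and `norm_linStep_sub_sq_le`, `norm_scsStep_sub_le` (`φ`
  nonexpansive), `norm_scsIter_sub_le` (Fejér monotonicity with respect to any fixed point);
* §3.4 "eliminating convergence to zero", for an arbitrary nonexpansive map whose fixed-point set
  is closed under positive scaling (`inner_iterate_ge_half`, `norm_iterate_ge`) and for SCS
  (`inner_scsIter_ge_half`, `norm_scsIter_ge`).

Not formalised: the linear-system and approximate-projection variants (§3.3, §4), the asymptotic
statement `Q u^k − v^k → 0` (§3.4, which [OCPB16] imports from ADMM convergence theory), stopping
criteria (§3.5). The dictionary to the concrete embedding of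
`Literature.Analysis.Convex.SelfDualEmbedding` (`u = (x, y, τ)`, `v = (0, s, κ)`, `Q` skew by
`skew_identity` there) is not spelled out: that file works over `m → ℝ` with `dotProduct`, this
one over an abstract inner product space.
-/

open scoped RealInnerProductSpace
open Literature.Analysis.Convex.MoreauDecomposition

namespace Literature.Analysis.Convex.SplittingConicSolver

variable {E : Type*} [NormedAddCommGroup E] [InnerProductSpace ℝ E] [CompleteSpace E]

/-! ## Skew operators and the resolvent `(I + Q)⁻¹` -/

/-- `Q` is **skew**: `⟨Q x, x⟩ = 0` for all `x` (for the embedding matrix, `Qᵀ = −Q`).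
[cite: OdonoghueEtAl2016, §3] -/
def IsSkew (Q : E →ₗ[ℝ] E) : Prop := ∀ x, ⟪Q x, x⟫ = 0

/-- `R` is the **resolvent** `(I + Q)⁻¹`: `R z + Q (R z) = z` for all `z` ("the matrix `I + Q` is
guaranteed to be invertible since `Q` is skew-symmetric"). [cite: OdonoghueEtAl2016, §3.2.2] -/
def IsResolvent (Q R : E →ₗ[ℝ] E) : Prop := ∀ z, R z + Q (R z) = z

variable {Q R : E →ₗ[ℝ] E} {K : ProperCone ℝ E}

omit [CompleteSpace E] in
/-- For skew `Q`, `⟨x, Q x⟩ = 0`. [cite: OdonoghueEtAl2016, §3] -/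
theorem inner_skew_apply_self (hQ : IsSkew Q) (x : E) : ⟪x, Q x⟫ = 0 := by
  rw [real_inner_comm]; exact hQ x

omit [CompleteSpace E] in
/-- For skew `Q`, `‖x + Q x‖² = ‖x‖² + ‖Q x‖²` (the cross term `2⟨x, Q x⟩` vanishes).
[cite: OdonoghueEtAl2016, Appendix (Nonexpansivity)] -/
theorem norm_add_skew_sq (hQ : IsSkew Q) (x : E) : ‖x + Q x‖ ^ 2 = ‖x‖ ^ 2 + ‖Q x‖ ^ 2 := by
  rw [norm_add_sq_real, inner_skew_apply_self hQ, mul_zero, add_zero]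

omit [CompleteSpace E] in
/-- The computation behind `‖L‖₂ = 1` in the appendix, as an identity for skew `Q`:
`‖z − b‖² + ‖Q z − b‖² = ‖(z + Q z) − b‖² + ‖b‖²` (expand and use `⟨z, Q z⟩ = 0`).
[cite: OdonoghueEtAl2016, Appendix (Nonexpansivity)] -/
theorem norm_sub_sq_add_norm_skew_sub_sq (hQ : IsSkew Q) (z b : E) :
    ‖z - b‖ ^ 2 + ‖Q z - b‖ ^ 2 = ‖z + Q z - b‖ ^ 2 + ‖b‖ ^ 2 := by
  rw [norm_sub_sq_real, norm_sub_sq_real, norm_sub_sq_real, norm_add_skew_sq hQ, inner_add_left]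
  ring

omit [CompleteSpace E] in
/-- `I + Q` is injective for skew `Q` (`⟨x + Q x, x⟩ = ‖x‖²`). [cite: OdonoghueEtAl2016, §3.2.2] -/
theorem add_skew_injective (hQ : IsSkew Q) : Function.Injective fun x => x + Q x := by
  intro x y h
  have hxy : x + Q x = y + Q y := h
  have h' : (x - y) + Q (x - y) = 0 := by
    rw [map_sub]
    calc x - y + (Q x - Q y) = (x + Q x) - (y + Q y) := by abel
      _ = 0 := sub_eq_zero.2 hxy
  have hn : ‖x - y‖ ^ 2 + ‖Q (x - y)‖ ^ 2 = 0 := by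
    rw [← norm_add_skew_sq hQ, h', norm_zero]; ring
  have h2 : ‖x - y‖ ^ 2 = 0 := by nlinarith [sq_nonneg ‖x - y‖, sq_nonneg ‖Q (x - y)‖]
  exact sub_eq_zero.1 (norm_eq_zero.1 ((pow_eq_zero_iff two_ne_zero).1 h2))

omit [CompleteSpace E] in
/-- `R z = x ⟺ x + Q x = z`: the resolvent is the two-sided inverse of `I + Q`.
[cite: OdonoghueEtAl2016, §3.2.2] -/
theorem resolvent_apply_eq_iff (hQ : IsSkew Q) (hR : IsResolvent Q R) {z x : E} :
    R z = x ↔ x + Q x = z := by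
  constructor
  · rintro rfl; exact hR z
  · intro h
    exact add_skew_injective hQ ((hR z).trans h.symm)

/-! ## One iteration of SCS (§3.2.3) -/

/-- The linear step followed by the shift, `L(u, v) = (I + Q)⁻¹(u + v) − v = ũ − v` (the point whose
Moreau decomposition gives `(u⁺, −v⁺)`). [cite: OdonoghueEtAl2016, §3.2.3; Appendix (Nonexpansivity)] -/
def linStep (R : E →ₗ[ℝ] E) (u v : E) : E := R (u + v) - v

/-- `u^{k+1} = Π_C(ũ^{k+1} − v^k)`. [cite: OdonoghueEtAl2016, §3.2.3] -/
noncomputable def nextU (K : ProperCone ℝ E) (R : E →ₗ[ℝ] E) (u v : E) : E :=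
  proj K (linStep R u v)

/-- `v^{k+1} = v^k − ũ^{k+1} + u^{k+1}` (written as `u^{k+1} − (ũ^{k+1} − v^k)`).
[cite: OdonoghueEtAl2016, §3.2.3] -/
noncomputable def nextV (K : ProperCone ℝ E) (R : E →ₗ[ℝ] E) (u v : E) : E :=
  nextU K R u v - linStep R u v

/-- The SCS iteration map `φ(u, v) = (u⁺, v⁺)` on the `L²` product.
[cite: OdonoghueEtAl2016, §3.2.3; §3.4] -/
noncomputable def scsStep (K : ProperCone ℝ E) (R : E →ₗ[ℝ] E) (z : WithLp 2 (E × E)) :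
    WithLp 2 (E × E) :=
  WithLp.toLp 2 (nextU K R z.fst z.snd, nextV K R z.fst z.snd)

/-- The SCS iterates `(u^k, v^k) = φ^k(u^0, v^0)`. [cite: OdonoghueEtAl2016, §3.2.3] -/
noncomputable def scsIter (K : ProperCone ℝ E) (R : E →ₗ[ℝ] E) (z₀ : WithLp 2 (E × E)) (k : ℕ) :
    WithLp 2 (E × E) :=
  (scsStep K R)^[k] z₀

/-- The `u`-component of `φ(u, v)`. [cite: OdonoghueEtAl2016, §3.2.3] -/
@[simp] theorem scsStep_fst (z : WithLp 2 (E × E)) :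
    (scsStep K R z).fst = nextU K R z.fst z.snd := rfl

/-- The `v`-component of `φ(u, v)`. [cite: OdonoghueEtAl2016, §3.2.3] -/
@[simp] theorem scsStep_snd (z : WithLp 2 (E × E)) :
    (scsStep K R z).snd = nextV K R z.fst z.snd := rfl

/-- `(u^0, v^0)` is the initial point. [cite: OdonoghueEtAl2016, §3.2.3] -/
@[simp] theorem scsIter_zero (z₀ : WithLp 2 (E × E)) : scsIter K R z₀ 0 = z₀ := rfl

/-- `(u^{k+1}, v^{k+1}) = φ(u^k, v^k)`. [cite: OdonoghueEtAl2016, §3.2.3; §3.4] -/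
theorem scsIter_succ (z₀ : WithLp 2 (E × E)) (k : ℕ) :
    scsIter K R z₀ (k + 1) = scsStep K R (scsIter K R z₀ k) := by
  simp only [scsIter, Function.iterate_succ_apply']

/-- The third line of (SCS) verbatim: `v^{k+1} = v^k − ũ^{k+1} + u^{k+1}` with
`ũ^{k+1} = (I + Q)⁻¹(u^k + v^k)`. [cite: OdonoghueEtAl2016, §3.2.3] -/
theorem nextV_eq (u v : E) : nextV K R u v = v - R (u + v) + nextU K R u v := by
  simp only [nextV, linStep]; abel

/-! ## §3.4: what holds at every iteration -/

/-- `u^{k+1} ∈ C`. [cite: OdonoghueEtAl2016, §3.4] -/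
theorem nextU_mem (u v : E) : nextU K R u v ∈ K := proj_mem

/-- `v^{k+1} ∈ C*` (`v^{k+1} = −(x − Π_C x) ∈ −C° = C*`). [cite: OdonoghueEtAl2016, §3.4] -/
theorem nextV_mem_innerDual (u v : E) : nextV K R u v ∈ ProperCone.innerDual (K : Set E) := by
  have h : linStep R u v - proj K (linStep R u v) ∈ polar K := sub_proj_mem_polar
  rw [mem_polar_iff_neg_mem_innerDual, neg_sub] at h
  exact h

/-- `(u^{k+1})ᵀ v^{k+1} = 0` (the two are the Moreau parts of one point).
[cite: OdonoghueEtAl2016, §3.4] -/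
theorem inner_nextU_nextV (u v : E) : ⟪nextU K R u v, nextV K R u v⟫ = 0 := by
  unfold nextV nextU
  rw [inner_sub_right, real_inner_self_eq_norm_sq]
  have h := inner_sub_proj_self (K := K) (x := linStep R u v)
  rw [inner_sub_left, real_inner_self_eq_norm_sq] at h
  have hc := real_inner_comm (proj K (linStep R u v)) (linStep R u v)
  linarith

/-- "The last step can be rewritten as `v^{k+1} = Π_{C*}(v^k − ũ^{k+1})`."
[cite: OdonoghueEtAl2016, §3.4] -/
theorem nextV_eq_proj_innerDual (u v : E) :
    nextV K R u v = proj (ProperCone.innerDual (K : Set E)) (v - R (u + v)) := by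
  have h := proj_polar_eq_neg_proj_innerDual_neg (K := K) (x := linStep R u v)
  rw [proj_polar_eq] at h
  unfold nextV nextU
  rw [← neg_sub, h, neg_neg, linStep, neg_sub]

/-- Along the orbit: `u^k ∈ C` for `k ≥ 1`. [cite: OdonoghueEtAl2016, §3.4] -/
theorem scsIter_fst_mem (z₀ : WithLp 2 (E × E)) (k : ℕ) : (scsIter K R z₀ (k + 1)).fst ∈ K := by
  rw [scsIter_succ, scsStep_fst]; exact nextU_mem _ _

/-- Along the orbit: `v^k ∈ C*` for `k ≥ 1`. [cite: OdonoghueEtAl2016, §3.4] -/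
theorem scsIter_snd_mem_innerDual (z₀ : WithLp 2 (E × E)) (k : ℕ) :
    (scsIter K R z₀ (k + 1)).snd ∈ ProperCone.innerDual (K : Set E) := by
  rw [scsIter_succ, scsStep_snd]; exact nextV_mem_innerDual _ _

/-- Along the orbit: `(u^k)ᵀ v^k = 0` for `k ≥ 1`. [cite: OdonoghueEtAl2016, §3.4] -/
theorem inner_scsIter_fst_snd (z₀ : WithLp 2 (E × E)) (k : ℕ) :
    ⟪(scsIter K R z₀ (k + 1)).fst, (scsIter K R z₀ (k + 1)).snd⟫ = 0 := by
  rw [scsIter_succ, scsStep_fst, scsStep_snd]; exact inner_nextU_nextV _ _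

/-! ## Homogeneity (§3.2.3) -/

/-- "If we scale the initial points by some factor `γ > 0`, then all subsequent iterates are also
scaled by `γ`." [cite: OdonoghueEtAl2016, §3.2.3] -/
theorem scsStep_smul {t : ℝ} (ht : 0 ≤ t) (z : WithLp 2 (E × E)) :
    scsStep K R (t • z) = t • scsStep K R z := by
  have hl : linStep R (t • z.fst) (t • z.snd) = t • linStep R z.fst z.snd := by
    simp only [linStep, ← smul_add, map_smul, smul_sub]
  have hu : nextU K R (t • z.fst) (t • z.snd) = t • nextU K R z.fst z.snd := by
    simp only [nextU, hl, proj_smul ht]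
  have hv : nextV K R (t • z.fst) (t • z.snd) = t • nextV K R z.fst z.snd := by
    simp only [nextV, hu, hl, smul_sub]
  rw [WithLp.ext_iff]
  ext <;> simp [scsStep, hu, hv]

/-- "… then all subsequent iterates are also scaled by `γ`": `φ^k(γ z^0) = γ φ^k(z^0)` for
`γ ≥ 0`. [cite: OdonoghueEtAl2016, §3.2.3] -/
theorem scsIter_smul {t : ℝ} (ht : 0 ≤ t) (z₀ : WithLp 2 (E × E)) (k : ℕ) :
    scsIter K R (t • z₀) k = t • scsIter K R z₀ k := by
  induction k with
  | zero => rfl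
  | succ k ih => rw [scsIter_succ, scsIter_succ, ih, scsStep_smul ht]

/-! ## Fixed points of `φ` are the solutions of the embedding (§3.4) -/

/-- `φ(u, v) = (u, v)` iff `u ∈ C`, `v ∈ C*` and `Q u = v` (the embedding's feasibility conditions;
`uᵀ v = 0` is automatic, `inner_skew_apply_self`): "since `(u⋆, v⋆)` is a solution … it is a fixed
point of `φ`", and conversely a fixed point has `ũ = u`, i.e. `(I + Q) u = u + v`.
[cite: OdonoghueEtAl2016, §3.4] -/
theorem scsStep_eq_self_iff (hQ : IsSkew Q) (hR : IsResolvent Q R) (z : WithLp 2 (E × E)) :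
    scsStep K R z = z ↔
      z.fst ∈ K ∧ z.snd ∈ ProperCone.innerDual (K : Set E) ∧ Q z.fst = z.snd := by
  constructor
  · intro h
    have hu : nextU K R z.fst z.snd = z.fst := by
      have := congrArg WithLp.fst h; simpa using this
    have hv : nextV K R z.fst z.snd = z.snd := by
      have := congrArg WithLp.snd h; simpa using this
    refine ⟨hu ▸ nextU_mem _ _, hv ▸ nextV_mem_innerDual _ _, ?_⟩
    -- from `v⁺ = v`: `ũ = u⁺ = u`, i.e. `R (u + v) = u`, i.e. `u + Q u = u + v`
    have ht : R (z.fst + z.snd) = z.fst := by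
      have e := nextV_eq (K := K) (R := R) z.fst z.snd
      rw [hv, hu] at e
      have : z.snd - R (z.fst + z.snd) + z.fst - z.snd = 0 := by rw [← e]; abel
      have : z.fst - R (z.fst + z.snd) = 0 := by rw [← this]; abel
      exact (sub_eq_zero.1 this).symm
    have := (resolvent_apply_eq_iff hQ hR).1 ht
    exact add_left_cancel this
  · rintro ⟨hu, hv, hq⟩
    have ht : R (z.fst + z.snd) = z.fst := (resolvent_apply_eq_iff hQ hR).2 (by rw [hq])
    have hl : linStep R z.fst z.snd = z.fst - z.snd := by rw [linStep, ht]
    have hp : proj K (z.fst - z.snd) = z.fst := by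
      symm
      refine eq_proj_iff.2 ⟨hu, ?_, ?_⟩
      · rw [sub_sub_cancel_left, mem_polar_iff_neg_mem_innerDual, neg_neg]; exact hv
      · rw [sub_sub_cancel_left, inner_neg_left, ← hq, hQ, neg_zero]
    have hu' : nextU K R z.fst z.snd = z.fst := by rw [nextU, hl, hp]
    have hv' : nextV K R z.fst z.snd = z.snd := by rw [nextV, hu', hl, sub_sub_cancel]
    rw [WithLp.ext_iff]
    ext <;> simp [hu', hv']

/-- In particular the fixed-point set is a cone: with `(u⋆, v⋆)` also `γ(u⋆, v⋆)`, `γ ≥ 0`, is a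
fixed point ("since the problem is homogeneous"). [cite: OdonoghueEtAl2016, §3.4] -/
theorem scsStep_smul_eq_self_of_eq {z : WithLp 2 (E × E)} (h : scsStep K R z = z) {t : ℝ}
    (ht : 0 ≤ t) : scsStep K R (t • z) = t • z := by
  rw [scsStep_smul ht, h]

/-! ## Appendix: nonexpansivity of `P`, `L` and `φ = P ∘ L` -/

/-- `P(x) = (Π_C x, −Π_{−C*} x) = (Π_C x, Π_C x − x)` is nonexpansive:
`‖Π x − Π x̂‖² + ‖(Π x − x) − (Π x̂ − x̂)‖² ≤ ‖x − x̂‖²` (from the Moreau decompositions of `x`, `x̂`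
and `Π_C(x̂)ᵀ Π_{−C*}(x) ≤ 0`; here via the firm nonexpansiveness of `Π_C`).
[cite: OdonoghueEtAl2016, Appendix (Nonexpansivity)] -/
theorem norm_proj_sub_sq_add_le (x x' : E) :
    ‖proj K x - proj K x'‖ ^ 2 + ‖(proj K x - x) - (proj K x' - x')‖ ^ 2 ≤ ‖x - x'‖ ^ 2 := by
  have f := norm_sub_sq_le_inner (K := K) x x'
  have e : (proj K x - x) - (proj K x' - x') = (proj K x - proj K x') - (x - x') := by abel
  have h2 : ‖(proj K x - proj K x') - (x - x')‖ ^ 2 =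
      ‖proj K x - proj K x'‖ ^ 2 - 2 * ⟪proj K x - proj K x', x - x'⟫ + ‖x - x'‖ ^ 2 :=
    norm_sub_sq_real _ _
  rw [e, h2]
  nlinarith [f]

omit [CompleteSpace E] in
/-- The identity behind `‖L‖₂ = 1`: with `a = u − û`, `b = v − v̂` and `z = (I + Q)⁻¹(a + b)`,
`‖L(u, v) − L(û, v̂)‖² + ‖Q z − b‖² = ‖a‖² + ‖b‖²` (the block row `[(I + Q)⁻¹, −(I − (I + Q)⁻¹)]`
times its transpose is `I` by skew-symmetry). [cite: OdonoghueEtAl2016, Appendix (Nonexpansivity)] -/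
theorem norm_linStep_sub_sq_add_eq (hQ : IsSkew Q) (hR : IsResolvent Q R) (u v u' v' : E) :
    ‖linStep R u v - linStep R u' v'‖ ^ 2 + ‖Q (R ((u - u') + (v - v'))) - (v - v')‖ ^ 2 =
      ‖u - u'‖ ^ 2 + ‖v - v'‖ ^ 2 := by
  obtain ⟨z, hz⟩ : ∃ z, z = R ((u - u') + (v - v')) := ⟨_, rfl⟩
  have hzq : z + Q z = (u - u') + (v - v') := by rw [hz]; exact hR _
  have hL : linStep R u v - linStep R u' v' = z - (v - v') := by
    rw [hz]; simp only [linStep, map_add, map_sub]; abel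
  have hab : u - u' = z + Q z - (v - v') := by rw [hzq]; abel
  rw [hL, ← hz, hab]
  exact norm_sub_sq_add_norm_skew_sub_sq hQ z (v - v')

omit [CompleteSpace E] in
/-- `L(u, v) = (I + Q)⁻¹(u + v) − v` is nonexpansive from the `L²` product:
`‖L(u, v) − L(û, v̂)‖² ≤ ‖u − û‖² + ‖v − v̂‖²`. [cite: OdonoghueEtAl2016, Appendix (Nonexpansivity)] -/
theorem norm_linStep_sub_sq_le (hQ : IsSkew Q) (hR : IsResolvent Q R) (u v u' v' : E) :
    ‖linStep R u v - linStep R u' v'‖ ^ 2 ≤ ‖u - u'‖ ^ 2 + ‖v - v'‖ ^ 2 := by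
  rw [← norm_linStep_sub_sq_add_eq hQ hR u v u' v']
  nlinarith [sq_nonneg ‖Q (R ((u - u') + (v - v'))) - (v - v')‖]

/-- **The SCS map is nonexpansive**: `‖φ(u, v) − φ(û, v̂)‖₂ ≤ ‖(u, v) − (û, v̂)‖₂`.
[cite: OdonoghueEtAl2016, §3.4; Appendix (Nonexpansivity)] -/
theorem norm_scsStep_sub_le (hQ : IsSkew Q) (hR : IsResolvent Q R) (z z' : WithLp 2 (E × E)) :
    ‖scsStep K R z - scsStep K R z'‖ ≤ ‖z - z'‖ := by
  have hsq : ‖scsStep K R z - scsStep K R z'‖ ^ 2 ≤ ‖z - z'‖ ^ 2 := by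
    rw [WithLp.prod_norm_sq_eq_of_L2, WithLp.prod_norm_sq_eq_of_L2, WithLp.sub_fst,
      WithLp.sub_snd, WithLp.sub_fst, WithLp.sub_snd, scsStep_fst, scsStep_snd, scsStep_fst,
      scsStep_snd]
    unfold nextV nextU
    exact (norm_proj_sub_sq_add_le _ _).trans (norm_linStep_sub_sq_le hQ hR _ _ _ _)
  exact (sq_le_sq₀ (norm_nonneg _) (norm_nonneg _)).1 hsq

/-- Fejér monotonicity: the distance to any fixed point (solution of the embedding) does not
increase, `‖(u^{k+1}, v^{k+1}) − z⋆‖ ≤ ‖(u^k, v^k) − z⋆‖`. [cite: OdonoghueEtAl2016, §3.4] -/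
theorem norm_scsIter_succ_sub_le (hQ : IsSkew Q) (hR : IsResolvent Q R) {p : WithLp 2 (E × E)}
    (hp : scsStep K R p = p) (z₀ : WithLp 2 (E × E)) (k : ℕ) :
    ‖scsIter K R z₀ (k + 1) - p‖ ≤ ‖scsIter K R z₀ k - p‖ := by
  rw [scsIter_succ]
  conv_lhs => rw [← hp]
  exact norm_scsStep_sub_le hQ hR _ _

/-- `‖(u^k, v^k) − z⋆‖ ≤ ‖(u^0, v^0) − z⋆‖` for every fixed point `z⋆` (the inequality (15) of
§3.4 with `z⋆ = γ(u⋆, v⋆)`). [cite: OdonoghueEtAl2016, §3.4] -/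
theorem norm_scsIter_sub_le (hQ : IsSkew Q) (hR : IsResolvent Q R) {p : WithLp 2 (E × E)}
    (hp : scsStep K R p = p) (z₀ : WithLp 2 (E × E)) (k : ℕ) :
    ‖scsIter K R z₀ k - p‖ ≤ ‖z₀ - p‖ := by
  induction k with
  | zero => rfl
  | succ k ih => exact (norm_scsIter_succ_sub_le hQ hR hp z₀ k).trans ih

/-! ## §3.4 "Eliminating convergence to zero" -/

section Nondegeneracy

variable {F : Type*} [NormedAddCommGroup F] [InnerProductSpace ℝ F]

/-- The argument of §3.4 in the abstract: if `φ` is nonexpansive and every positive multiple `γ p`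
of `p` is a fixed point, then from `‖φ^k x₀ − γ p‖² ≤ ‖x₀ − γ p‖²` with
`γ = ‖x₀‖² / ⟨p, x₀⟩ > 0` one gets `⟨φ^k x₀, p⟩ ≥ ⟨p, x₀⟩ / 2`. [cite: OdonoghueEtAl2016, §3.4] -/
theorem inner_iterate_ge_half {φ : F → F} (hφ : ∀ x y, ‖φ x - φ y‖ ≤ ‖x - y‖) {p x₀ : F}
    (hp : ∀ t : ℝ, 0 < t → φ (t • p) = t • p) (h0 : 0 < ⟪p, x₀⟫) (k : ℕ) :
    ⟪p, x₀⟫ / 2 ≤ ⟪φ^[k] x₀, p⟫ := by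
  have hx0 : 0 < ‖x₀‖ := by
    refine norm_pos_iff.2 ?_
    rintro rfl
    simp at h0
  set t := ‖x₀‖ ^ 2 / ⟪p, x₀⟫ with ht
  have htpos : 0 < t := div_pos (by positivity) h0
  -- nonexpansiveness iterated against the fixed point `t • p`
  have hk : ∀ k : ℕ, ‖φ^[k] x₀ - t • p‖ ≤ ‖x₀ - t • p‖ := by
    intro k
    induction k with
    | zero => rfl
    | succ k ih =>
      rw [Function.iterate_succ_apply']
      calc ‖φ (φ^[k] x₀) - t • p‖ = ‖φ (φ^[k] x₀) - φ (t • p)‖ := by rw [hp t htpos]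
        _ ≤ ‖φ^[k] x₀ - t • p‖ := hφ _ _
        _ ≤ ‖x₀ - t • p‖ := ih
  have h1 := hk k
  have h2 : ‖φ^[k] x₀ - t • p‖ ^ 2 ≤ ‖x₀ - t • p‖ ^ 2 := pow_le_pow_left₀ (norm_nonneg _) h1 2
  rw [norm_sub_sq_real, norm_sub_sq_real, real_inner_smul_right, real_inner_smul_right] at h2
  have hc : ⟪x₀, p⟫ = ⟪p, x₀⟫ := real_inner_comm _ _
  rw [hc] at h2
  have e : t * ⟪p, x₀⟫ = ‖x₀‖ ^ 2 := by rw [ht]; field_simp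
  -- `‖φ^k x₀‖² − 2 t ⟨φ^k x₀, p⟩ ≤ ‖x₀‖² − 2 ‖x₀‖² = −‖x₀‖²`
  have h4 := sq_nonneg ‖φ^[k] x₀‖
  have h3 : 2 * t * ⟪φ^[k] x₀, p⟫ ≥ ‖x₀‖ ^ 2 := by linarith
  -- divide by `2 t` and use `‖x₀‖² / t = ⟨p, x₀⟩`
  have e2 : ‖x₀‖ ^ 2 / (2 * t) = ⟪p, x₀⟫ / 2 := by
    rw [ht]; field_simp
  rw [← e2, div_le_iff₀ (by positivity)]
  linarith

/-- … "and applying Cauchy–Schwarz yields" `‖φ^k x₀‖ ≥ ⟨p, x₀⟩ / (2‖p‖) > 0`: the iterates are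
bounded away from zero. [cite: OdonoghueEtAl2016, §3.4] -/
theorem norm_iterate_ge {φ : F → F} (hφ : ∀ x y, ‖φ x - φ y‖ ≤ ‖x - y‖) {p x₀ : F}
    (hp : ∀ t : ℝ, 0 < t → φ (t • p) = t • p) (h0 : 0 < ⟪p, x₀⟫) (k : ℕ) :
    ⟪p, x₀⟫ / (2 * ‖p‖) ≤ ‖φ^[k] x₀‖ := by
  have hp0 : 0 < ‖p‖ := by
    refine norm_pos_iff.2 ?_
    rintro rfl
    simp at h0
  have h1 := inner_iterate_ge_half hφ hp h0 k
  have h2 : ⟪φ^[k] x₀, p⟫ ≤ ‖φ^[k] x₀‖ * ‖p‖ := real_inner_le_norm _ _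
  rw [div_le_iff₀ (by positivity)]
  nlinarith [h1, h2]

/-- The lower bound is positive. [cite: OdonoghueEtAl2016, §3.4] -/
theorem norm_iterate_pos {φ : F → F} (hφ : ∀ x y, ‖φ x - φ y‖ ≤ ‖x - y‖) {p x₀ : F}
    (hp : ∀ t : ℝ, 0 < t → φ (t • p) = t • p) (h0 : 0 < ⟪p, x₀⟫) (k : ℕ) : 0 < ‖φ^[k] x₀‖ := by
  have hp0 : 0 < ‖p‖ := by
    refine norm_pos_iff.2 ?_
    rintro rfl
    simp at h0
  exact lt_of_lt_of_le (div_pos h0 (by positivity)) (norm_iterate_ge hφ hp h0 k)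

end Nondegeneracy

/-- **SCS does not converge to zero** (§3.4): if `z⋆ = (u⋆, v⋆)` solves the embedding and the
initial point has `⟨z⋆, z^0⟩ > 0` (e.g. `u^0_τ = v^0_κ = 1`, all else zero, when `u⋆_τ + v⋆_κ > 0`),
then `⟨(u^k, v^k), (u⋆, v⋆)⟩ ≥ ⟨(u⋆, v⋆), (u^0, v^0)⟩ / 2` for all `k`.
[cite: OdonoghueEtAl2016, §3.4] -/
theorem inner_scsIter_ge_half (hQ : IsSkew Q) (hR : IsResolvent Q R) {p : WithLp 2 (E × E)}
    (hp : scsStep K R p = p) {z₀ : WithLp 2 (E × E)} (h0 : 0 < ⟪p, z₀⟫) (k : ℕ) :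
    ⟪p, z₀⟫ / 2 ≤ ⟪scsIter K R z₀ k, p⟫ :=
  inner_iterate_ge_half (norm_scsStep_sub_le hQ hR)
    (fun _ ht => scsStep_smul_eq_self_of_eq hp ht.le) h0 k

/-- … and `‖(u^k, v^k)‖₂ ≥ ⟨(u⋆, v⋆), (u^0, v^0)⟩ / (2‖(u⋆, v⋆)‖₂) > 0`: "for `k = 1, 2, …` the
iterates are bounded away from zero". [cite: OdonoghueEtAl2016, §3.4] -/
theorem norm_scsIter_ge (hQ : IsSkew Q) (hR : IsResolvent Q R) {p : WithLp 2 (E × E)}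
    (hp : scsStep K R p = p) {z₀ : WithLp 2 (E × E)} (h0 : 0 < ⟪p, z₀⟫) (k : ℕ) :
    ⟪p, z₀⟫ / (2 * ‖p‖) ≤ ‖scsIter K R z₀ k‖ :=
  norm_iterate_ge (norm_scsStep_sub_le hQ hR) (fun _ ht => scsStep_smul_eq_self_of_eq hp ht.le) h0 k

/-- "Thus, for `k = 1, 2, …`, the iterates are bounded away from zero" (in particular non-zero, so
the normalisation `(u^k, v^k)/‖(u^k, v^k)‖₂` of §3.4 is defined). [cite: OdonoghueEtAl2016, §3.4] -/
theorem norm_scsIter_pos (hQ : IsSkew Q) (hR : IsResolvent Q R) {p : WithLp 2 (E × E)}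
    (hp : scsStep K R p = p) {z₀ : WithLp 2 (E × E)} (h0 : 0 < ⟪p, z₀⟫) (k : ℕ) :
    0 < ‖scsIter K R z₀ k‖ :=
  norm_iterate_pos (norm_scsStep_sub_le hQ hR) (fun _ ht => scsStep_smul_eq_self_of_eq hp ht.le) h0 k

end Literature.Analysis.Convex.SplittingConicSolver
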